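import Literature.Geometry.Symplectic.JPlanePencilMemberCap
import Literature.Geometry.Manifold.InjOnLocalDiffeomorphInverse
import HarnessLib

/-!
# The cap of a pencil member is a graph near the base point; a defining function through `p`

Support theorems (no named facts, D-0026) for
`Literature.Geometry.Symplectic.jPlanePencil_localFamily_homotopySphere`
(`JPlanePencilLocalFamily.lean`; C. Wendl, *Holomorphic Curves in Low Dimensions* (2018),
Prop. 2.53 with `m = 1`, for homotopy 4-spheres), continuing `JPlanePencilMemberCap.lean`.

In the universality clause of Prop. 2.53 (`m = 1`) one counts the intersections of a member `u'`
with the closed-up leaf `K = u(ℂ) ∪ {p}` of another member `u` INSIDE `M`; at the constraint point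
`p` itself this needs a smooth defining function of `K` on a neighbourhood of `p`. In the split
flat coordinates `(x₁, x₂) = flatCx (e y − e p)` of the chart at `p` the cap of `u` is
`η ↦ (x₁, x₂) = ((1 + |W|²)⁻¹ conj X, W · x₁)` (`capModel`), and `σ = x₁ ∘ cap` has the
invertible (conjugate-linear) differential `η ↦ conj η` at `0`; so near `p` the leaf `K` is the
graph `x₂ = Ŵ(x₁) · x₁`, `Ŵ = W ∘ σ⁻¹`, and `π_p = x₂ − Ŵ(x₁) · x₁` is a smooth defining
function of `K` near `p` (`capDefFn`), with the EXACT factorisation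
`π_p (y) = x₁(y) · (W(y) − Ŵ(x₁(y)))`, `W(y) = w(y)/z(y)`, at every point with `z(y) ≠ 0`
(`capDefFn_eq_mul`) — the form in which the local intersection index at `p` of two members is
computed (the factor `x₁ ∘ cap' ≈ conj η` winds `−1`, the factor `W' − Ŵ(x₁')` carries the order of
contact of the two far graphs at infinity).

* `flatCx_capModel_fst/snd`, `flatCx_capModel_snd_eq_mul` — `x₂ = W · x₁` along caps;
  `flatCx_extChartAt_sub_snd_eq_mul` — `x₂(y) = W(y) · x₁(y)` for every `y` with `z(y) ≠ 0`.
* `capFst p u = x₁ ∘ cap`, `IsPencilPlane.hasFDerivAt_capFst_zero` (`dσ(0) = conj`),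
  `IsPencilPlane.exists_capFst_goodDisc` — an open disc `S ∋ 0` inside the cap disc on which `σ`
  is smooth, injective, with bijective differential, so that `σ(S)` is open and `σ⁻¹` is smooth on
  it (`contMDiffOn_invFunOn_of_bijective_mfderiv`, Lee 2013 Thm. 4.5).
* `capDefFn p u S y = x₂(y) − W(σ⁻¹(x₁(y))) · x₁(y)`; `IsPencilPlane.contMDiffOn_capDefFn`;
  `IsPencilPlane.capDefFn_zeroSet` — on the open set `capDefDom p u S ∋ p` its zero set is exactly
  `pencilCap p u '' S` (the shape of the leaf-coordinate hypothesis of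
  `positivityOfIntersections_leafCoordinate`); `capDefFn_eq_mul` — the factorisation.

## References

* C. Wendl, *Holomorphic Curves in Low Dimensions*, LNM 2216, Springer (2018), Prop. 2.53 and
  Thm. 2.49. [Wendl2018]
* J. M. Lee, *Introduction to Smooth Manifolds*, 2nd ed. (2013), Thm. 4.5. [LeeSmoothManifolds2013]
-/

noncomputable section

open scoped Manifold ContDiff Topology ComplexConjugate
open Set Function Filter Metric Complex

namespace Literature.Geometry.Symplectic

/-! ### §1 Split flat coordinates along caps: `x₂ = W · x₁` -/

section Algebra

/-- First split flat coordinate of the cap model: `x₁ = (1 + |W|²)⁻¹ · conj X`. [folklore] -/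
theorem flatCx_capModel_fst (X W : ℂ) :
    (flatCx (capModel (X, W))).1 = ((1 + ‖W‖ ^ 2)⁻¹ : ℝ) • conj X := by
  rw [capModel_apply, ContinuousLinearEquiv.apply_symm_apply, Prod.smul_fst]

/-- Second split flat coordinate of the cap model: `x₂ = (1 + |W|²)⁻¹ · (W · conj X)`. [folklore] -/
theorem flatCx_capModel_snd (X W : ℂ) :
    (flatCx (capModel (X, W))).2 = ((1 + ‖W‖ ^ 2)⁻¹ : ℝ) • (W * conj X) := by
  rw [capModel_apply, ContinuousLinearEquiv.apply_symm_apply, Prod.smul_snd]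

/-- **Along a cap, `x₂ = W · x₁`.** [folklore] -/
theorem flatCx_capModel_snd_eq_mul (X W : ℂ) :
    (flatCx (capModel (X, W))).2 = W * (flatCx (capModel (X, W))).1 := by
  rw [flatCx_capModel_fst, flatCx_capModel_snd, Complex.real_smul, Complex.real_smul]
  ring

variable {M : Type*} [TopologicalSpace M] [T2Space M] [ChartedSpace (EuclideanSpace ℝ (Fin 4)) M]

/-- **`x₂(y) = W(y) · x₁(y)` at every point with `z(y) ≠ 0`**, where
`(x₁, x₂) = flatCx (e y − e p)` and `W(y) = w(y) / z(y)`. [folklore] -/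
theorem flatCx_extChartAt_sub_snd_eq_mul (p : M) (x : punctured p) (hz : (pencilCoord p x).1 ≠ 0) :
    (flatCx (extChartAt (𝓡 4) p x.1 - extChartAt (𝓡 4) p p)).2 =
      (pencilCoord p x).2 / (pencilCoord p x).1 *
        (flatCx (extChartAt (𝓡 4) p x.1 - extChartAt (𝓡 4) p p)).1 := by
  rw [extChartAt_sub_eq_inversion_pencilCoord, ← Prod.mk.eta (p := pencilCoord p x),
    ← capModel_eq_inversion hz, flatCx_capModel_snd_eq_mul]

/-- `x₁(y) = (1 + |W(y)|²)⁻¹ conj (1 / z(y))` at every point with `z(y) ≠ 0`. [folklore] -/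
theorem flatCx_extChartAt_sub_fst_eq (p : M) (x : punctured p) (hz : (pencilCoord p x).1 ≠ 0) :
    (flatCx (extChartAt (𝓡 4) p x.1 - extChartAt (𝓡 4) p p)).1 =
      ((1 + ‖(pencilCoord p x).2 / (pencilCoord p x).1‖ ^ 2)⁻¹ : ℝ) •
        conj ((pencilCoord p x).1)⁻¹ := by
  rw [extChartAt_sub_eq_inversion_pencilCoord, ← Prod.mk.eta (p := pencilCoord p x),
    ← capModel_eq_inversion hz, flatCx_capModel_fst]

end Algebra

/-! ### §2 `σ = x₁ ∘ cap` is a local diffeomorphism at `0` -/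

section Sigma

variable {M : Type*} [TopologicalSpace M] [T2Space M] [ChartedSpace (EuclideanSpace ℝ (Fin 4)) M]

/-- `σ(η) = x₁ (cap η) = (1 + |W η|²)⁻¹ conj (X η)`: the first split flat coordinate along the
cap chart. [folklore] -/
def capFst (p : M) (u : ℂ → punctured p) (η : ℂ) : ℂ :=
  (flatCx (capModel (capX p u η, capW p u η))).1

variable {p : M} {u : ℂ → punctured p}

/-- Unfolding `capFst`. [folklore] -/
theorem capFst_eq (η : ℂ) :
    capFst p u η = ((1 + ‖capW p u η‖ ^ 2)⁻¹ : ℝ) • conj (capX p u η) := by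
  rw [capFst, flatCx_capModel_fst]

/-- `σ(0) = 0`. [folklore] -/
@[simp] theorem capFst_zero : capFst p u 0 = 0 := by simp [capFst_eq]

/-- `x₂ (cap η) = W η · σ η`. [folklore] -/
theorem flatCx_capModel_cap_snd (η : ℂ) :
    (flatCx (capModel (capX p u η, capW p u η))).2 = capW p u η * capFst p u η := by
  rw [capFst, flatCx_capModel_snd_eq_mul]

end Sigma

namespace IsPencilPlane

variable {M : Type*} [TopologicalSpace M] [T2Space M] [SecondCountableTopology M] [CompactSpace M]
  [ChartedSpace (EuclideanSpace ℝ (Fin 4)) M] [IsManifold (𝓡 4) ∞ M]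
  {p : M} {J : ∀ x : punctured p, TangentSpace (𝓡 4) x →L[ℝ] TangentSpace (𝓡 4) x}
  {u : ℂ → punctured p} {b : ℂ} {ε : ℝ}

omit [SecondCountableTopology M] in
/-- `σ` is smooth on the disc of `IsPencilPlane.exists_differentiableOn_compactification`.
[folklore] -/
theorem contDiffOn_capFst (h : IsPencilPlane J u b) (hε : 0 < ε)
    (hJstd : ∀ x : punctured p, InPuncturedChartBall p ε x →
      ∀ (v : TangentSpace (𝓡 4) x) (c : EuclideanSpace ℝ (Fin 4)),
        inner ℝ (fderiv ℝ inversion (extChartAt (𝓡 4) p x.1 - extChartAt (𝓡 4) p p)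
          (mfderiv (𝓡 4) 𝓘(ℝ, EuclideanSpace ℝ (Fin 4))
            (fun z : punctured p => extChartAt (𝓡 4) p z.1) x (J x v))) c
        = stdSymplecticForm (fderiv ℝ inversion (extChartAt (𝓡 4) p x.1 - extChartAt (𝓡 4) p p)
          (mfderiv (𝓡 4) 𝓘(ℝ, EuclideanSpace ℝ (Fin 4))
            (fun z : punctured p => extChartAt (𝓡 4) p z.1) x v)) c) :
    ∃ r : ℝ, 0 < r ∧ ContDiffOn ℝ ∞ (capFst p u) (ball 0 r) ∧
      ContDiffOn ℝ ∞ (capW p u) (ball 0 r) ∧ ContDiffOn ℝ ∞ (capX p u) (ball 0 r) := by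
  obtain ⟨r, hr, hX, hW⟩ := h.exists_differentiableOn_compactification hε hJstd
  have hXr : ContDiffOn ℝ ∞ (capX p u) (ball 0 r) := (hX.contDiffOn isOpen_ball).restrict_scalars ℝ
  have hWr : ContDiffOn ℝ ∞ (capW p u) (ball 0 r) := (hW.contDiffOn isOpen_ball).restrict_scalars ℝ
  refine ⟨r, hr, ?_, hWr, hXr⟩
  have h1 : ContDiffOn ℝ ∞ (fun η => ((1 + ‖capW p u η‖ ^ 2)⁻¹ : ℝ)) (ball 0 r) := by
    refine ContDiffOn.inv (contDiffOn_const.add (hWr.norm_sq ℝ)) ?_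
    intro η _; positivity
  have h2 : ContDiffOn ℝ ∞ (fun η => conj (capX p u η)) (ball 0 r) :=
    Complex.conjCLE.contDiff.comp_contDiffOn hXr
  have : capFst p u = fun η => ((1 + ‖capW p u η‖ ^ 2)⁻¹ : ℝ) • conj (capX p u η) := by
    funext η; exact capFst_eq η
  rw [this]
  exact h1.smul h2

omit [SecondCountableTopology M] [CompactSpace M] [IsManifold (𝓡 4) ∞ M] in
/-- **`dσ(0) = conj`**: the differential of `σ = x₁ ∘ cap` at `0` is complex conjugation
(`X(0) = 0`, `X'(0) = 1`, and the real factor is `1` at `0`). [cite: Wendl2018, Prop. 2.53 (p. 65)] -/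
theorem hasFDerivAt_capFst_zero (h : IsPencilPlane J u b) :
    HasFDerivAt (capFst p u) (Complex.conjCLE : ℂ →L[ℝ] ℂ) 0 := by
  have hXd : HasDerivAt (capX p u) 1 0 := by rw [capX_eq]; exact h.hasDerivAt_inv_fst_zero
  have hWd : HasDerivAt (capW p u) b 0 := by rw [capW_eq]; exact h.hasDerivAt_snd_div_fst_zero
  set φ : ℂ → ℝ := fun η' => (1 + ‖capW p u η'‖ ^ 2)⁻¹ with hφ
  set f : ℂ → ℂ := fun η' => conj (capX p u η') with hf
  have hφd : DifferentiableAt ℝ φ 0 := by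
    have h1 : DifferentiableAt ℝ (fun η' => 1 + ‖capW p u η'‖ ^ 2) 0 :=
      (differentiableAt_const _).add ((hWd.differentiableAt.restrictScalars ℝ).norm_sq ℝ)
    exact h1.inv (by positivity)
  set f' : ℂ →L[ℝ] ℂ := (Complex.conjCLE : ℂ →L[ℝ] ℂ).comp
      ((ContinuousLinearMap.smulRight (1 : ℂ →L[ℂ] ℂ) (1 : ℂ)).restrictScalars ℝ) with hf'
  have hfd : HasFDerivAt f f' 0 :=
    Complex.conjCLE.hasFDerivAt.comp 0 (hXd.hasFDerivAt.restrictScalars ℝ)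
  set T : ℂ →L[ℝ] ℂ := (φ 0) • f' + (fderiv ℝ φ 0).smulRight (f 0) with hT
  have hk : HasFDerivAt (fun η' => φ η' • f η') T 0 := hφd.hasFDerivAt.smul hfd
  have hf0 : f 0 = 0 := by simp [hf]
  have hφ0 : φ 0 = 1 := by simp [hφ]
  have hTe : T = (Complex.conjCLE : ℂ →L[ℝ] ℂ) := by
    ext1 v
    simp [hT, hf0, hφ0, hf']
  have hfun : capFst p u = fun η' => φ η' • f η' := by
    funext η; exact capFst_eq η
  rw [hfun, ← hTe]
  exact hk

omit [SecondCountableTopology M] in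
/-- **A good disc for `σ`.** There is `r > 0`, within the cap radius (so the chart formula
`e (cap η) = e p + capModel (X η, W η)` holds and `z ≠ 0` on the punctured disc), on whose disc
`σ` and `W` are smooth, `σ` is injective and `dσ` is bijective at every point.
[cite: LeeSmoothManifolds2013, Thm. 4.5] -/
theorem exists_capFst_goodDisc (h : IsPencilPlane J u b) (hε : 0 < ε)
    (hJstd : ∀ x : punctured p, InPuncturedChartBall p ε x →
      ∀ (v : TangentSpace (𝓡 4) x) (c : EuclideanSpace ℝ (Fin 4)),
        inner ℝ (fderiv ℝ inversion (extChartAt (𝓡 4) p x.1 - extChartAt (𝓡 4) p p)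
          (mfderiv (𝓡 4) 𝓘(ℝ, EuclideanSpace ℝ (Fin 4))
            (fun z : punctured p => extChartAt (𝓡 4) p z.1) x (J x v))) c
        = stdSymplecticForm (fderiv ℝ inversion (extChartAt (𝓡 4) p x.1 - extChartAt (𝓡 4) p p)
          (mfderiv (𝓡 4) 𝓘(ℝ, EuclideanSpace ℝ (Fin 4))
            (fun z : punctured p => extChartAt (𝓡 4) p z.1) x v)) c) :
    ∃ r : ℝ, 0 < r ∧
      (∀ η : ℂ, η ≠ 0 → ‖η‖ < r →
        InPuncturedChartBall p ε (u η⁻¹) ∧ 1 < ‖(pencilCoord p (u η⁻¹)).1‖) ∧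
      ContDiffOn ℝ ∞ (capFst p u) (ball 0 r) ∧ ContDiffOn ℝ ∞ (capW p u) (ball 0 r) ∧
      InjOn (capFst p u) (ball 0 r) ∧
      ∀ η ∈ ball (0 : ℂ) r, Bijective (fderiv ℝ (capFst p u) η) := by
  obtain ⟨r₁, hr₁, hball⟩ := h.exists_cap_radius hε
  obtain ⟨r₂, hr₂, hσ, hW, -⟩ := h.contDiffOn_capFst hε hJstd
  have hσ0 : ContDiffAt ℝ ∞ (capFst p u) 0 :=
    hσ.contDiffAt (isOpen_ball.mem_nhds (mem_ball_self hr₂))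
  have hfd : fderiv ℝ (capFst p u) 0 = (Complex.conjCLE : ℂ →L[ℝ] ℂ) :=
    h.hasFDerivAt_capFst_zero.fderiv
  -- injectivity near `0` (inverse function theorem)
  have hstrict : HasStrictFDerivAt (capFst p u) ((Complex.conjCLE : ℂ ≃L[ℝ] ℂ) : ℂ →L[ℝ] ℂ) 0 := by
    have h1 := hσ0.hasStrictFDerivAt (by simp)
    rwa [hfd] at h1
  obtain ⟨s₁, hs₁, hinj⟩ : ∃ s ∈ 𝓝 (0 : ℂ), InjOn (capFst p u) s :=
    ⟨_, (hstrict.toOpenPartialHomeomorph _).open_source.mem_nhds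
      hstrict.mem_toOpenPartialHomeomorph_source,
      (hstrict.toOpenPartialHomeomorph _).injOn⟩
  -- bijective differential near `0` (invertibility is open, `dσ` is continuous)
  have hcont : ContinuousAt (fun η => fderiv ℝ (capFst p u) η) 0 :=
    (hσ.continuousOn_fderiv_of_isOpen isOpen_ball (by simp)).continuousAt
      (isOpen_ball.mem_nhds (mem_ball_self hr₂))
  have hmem : fderiv ℝ (capFst p u) 0 ∈ range ((↑) : (ℂ ≃L[ℝ] ℂ) → ℂ →L[ℝ] ℂ) :=
    ⟨Complex.conjCLE, hfd.symm⟩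
  obtain ⟨s₂, hs₂, hbij⟩ : ∃ s ∈ 𝓝 (0 : ℂ), ∀ η ∈ s, Bijective (fderiv ℝ (capFst p u) η) := by
    refine ⟨_, hcont.preimage_mem_nhds
      ((ContinuousLinearEquiv.isOpen (𝕜 := ℝ) (E := ℂ) (F := ℂ)).mem_nhds hmem), fun η hη => ?_⟩
    obtain ⟨e, he⟩ := hη
    have he' : fderiv ℝ (capFst p u) η = (e : ℂ →L[ℝ] ℂ) := by simpa using he.symm
    rw [he']
    exact e.bijective
  obtain ⟨r₃, hr₃, hr₃s⟩ := Metric.mem_nhds_iff.1 (inter_mem hs₁ hs₂)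
  set r : ℝ := min (min r₁ r₂) r₃ with hr_def
  have hr : 0 < r := lt_min (lt_min hr₁ hr₂) hr₃
  have hrr₁ : r ≤ r₁ := le_trans (min_le_left _ _) (min_le_left _ _)
  have hrr₂ : r ≤ r₂ := le_trans (min_le_left _ _) (min_le_right _ _)
  have hrr₃ : r ≤ r₃ := min_le_right _ _
  refine ⟨r, hr, fun η hη0 hη => hball η hη0 (lt_of_lt_of_le hη hrr₁),
    hσ.mono (ball_subset_ball hrr₂), hW.mono (ball_subset_ball hrr₂),
    hinj.mono fun η hη => (hr₃s (ball_subset_ball hrr₃ hη)).1,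
    fun η hη => hbij η (hr₃s (ball_subset_ball hrr₃ hη)).2⟩

end IsPencilPlane

/-! ### §3 The defining function `π_p = x₂ − Ŵ(x₁) · x₁` of the closed-up leaf near `p` -/

section DefFn

variable {M : Type*} [TopologicalSpace M] [ChartedSpace (EuclideanSpace ℝ (Fin 4)) M]

/-- The split flat coordinates `(x₁, x₂)(y) = flatCx (e y − e p)` of the chart at `p`. [folklore] -/
def flatPair (p : M) (y : M) : ℂ × ℂ :=
  flatCx (extChartAt (𝓡 4) p y - extChartAt (𝓡 4) p p)

/-- `flatPair p p = 0`. [folklore] -/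
@[simp] theorem flatPair_base {p : M} : flatPair p p = 0 := by simp [flatPair]

/-- The split flat coordinates are smooth on the chart source. [folklore] -/
theorem contMDiffOn_flatPair [IsManifold (𝓡 4) ∞ M] (p : M) :
    ContMDiffOn (𝓡 4) 𝓘(ℝ, ℂ × ℂ) ∞ (flatPair p) (chartAt (EuclideanSpace ℝ (Fin 4)) p).source := by
  have hg : ContDiff ℝ ∞ fun v : EuclideanSpace ℝ (Fin 4) => flatCx (v - extChartAt (𝓡 4) p p) :=
    flatCx.contDiff.comp (contDiff_id.sub contDiff_const)
  intro y hy
  exact hg.comp_contMDiffWithinAt (contMDiffOn_extChartAt y hy)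

variable [T2Space M]

/-- `Ŵ = W ∘ σ⁻¹`, the slope function of the cap read in the coordinate `x₁`, with `σ⁻¹` the
inverse of `σ = x₁ ∘ cap` on the disc of radius `r`. [cite: Wendl2018, Prop. 2.53 (p. 65)] -/
def capSlope (p : M) (u : ℂ → punctured p) (r : ℝ) (x₁ : ℂ) : ℂ :=
  capW p u (invFunOn (capFst p u) (ball 0 r) x₁)

/-- **The defining function of the closed-up leaf near `p`**:
`π_p (y) = x₂(y) − Ŵ(x₁(y)) · x₁(y)`. [cite: Wendl2018, Prop. 2.53 with Thm. 2.49] -/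
def capDefFn (p : M) (u : ℂ → punctured p) (r : ℝ) (y : M) : ℂ :=
  (flatPair p y).2 - capSlope p u r (flatPair p y).1 * (flatPair p y).1

/-- Its domain: chart-source points whose coordinate `x₁` lies in `σ (ball 0 r)`. [folklore] -/
def capDefDom (p : M) (u : ℂ → punctured p) (r : ℝ) : Set M :=
  {y | y ∈ (chartAt (EuclideanSpace ℝ (Fin 4)) p).source ∧ (flatPair p y).1 ∈ capFst p u '' ball 0 r}

variable {p : M} {u : ℂ → punctured p} {r : ℝ}

/-- The base point lies in the domain (for `0 < r`). [folklore] -/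
theorem base_mem_capDefDom (hr : 0 < r) : p ∈ capDefDom p u r :=
  ⟨mem_chart_source _ p, ⟨0, mem_ball_self hr, by simp⟩⟩

/-- **The exact factorisation** `π_p (y) = x₁(y) · (W(y) − Ŵ(x₁(y)))` at every point with
`z(y) ≠ 0`, `W(y) = w(y)/z(y)`. [cite: Wendl2018, Prop. 2.53 with Thm. 2.49] -/
theorem capDefFn_eq_mul (x : punctured p) (hz : (pencilCoord p x).1 ≠ 0) :
    capDefFn p u r x.1 = (flatPair p x.1).1 *
      ((pencilCoord p x).2 / (pencilCoord p x).1 - capSlope p u r (flatPair p x.1).1) := by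
  rw [capDefFn, flatPair, flatCx_extChartAt_sub_snd_eq_mul p x hz]
  ring

/-- `Ŵ (σ η) = W η` on the disc (injectivity of `σ`). [folklore] -/
theorem capSlope_capFst (hinj : InjOn (capFst p u) (ball 0 r)) {η : ℂ} (hη : η ∈ ball (0 : ℂ) r) :
    capSlope p u r (capFst p u η) = capW p u η := by
  rw [capSlope, Literature.Geometry.Manifold.invFunOn_apply hinj hη]

/-- `σ (ball 0 r)` is open when `dσ` is bijective on the disc. [cite: LeeSmoothManifolds2013, Prop. 4.8] -/
theorem isOpen_image_capFst (hσ : ContDiffOn ℝ ∞ (capFst p u) (ball 0 r))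
    (hbij : ∀ η ∈ ball (0 : ℂ) r, Bijective (fderiv ℝ (capFst p u) η)) :
    IsOpen (capFst p u '' ball 0 r) := by
  refine Literature.Geometry.Manifold.isOpen_image_of_bijective_mfderiv
    (I := 𝓘(ℝ, ℂ)) (J := 𝓘(ℝ, ℂ)) isOpen_ball hσ.contMDiffOn fun η hη => ?_
  rw [mfderiv_eq_fderiv]
  exact hbij η hη

/-- `Ŵ` is smooth on `σ (ball 0 r)`. [cite: LeeSmoothManifolds2013, Thm. 4.5] -/
theorem contDiffOn_capSlope (hσ : ContDiffOn ℝ ∞ (capFst p u) (ball 0 r))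
    (hW : ContDiffOn ℝ ∞ (capW p u) (ball 0 r)) (hinj : InjOn (capFst p u) (ball 0 r))
    (hbij : ∀ η ∈ ball (0 : ℂ) r, Bijective (fderiv ℝ (capFst p u) η)) :
    ContDiffOn ℝ ∞ (capSlope p u r) (capFst p u '' ball 0 r) := by
  have hinv : ContMDiffOn 𝓘(ℝ, ℂ) 𝓘(ℝ, ℂ) ∞ (invFunOn (capFst p u) (ball 0 r))
      (capFst p u '' ball 0 r) :=
    Literature.Geometry.Manifold.contMDiffOn_invFunOn_of_bijective_mfderiv
      (I := 𝓘(ℝ, ℂ)) (J := 𝓘(ℝ, ℂ)) isOpen_ball hσ.contMDiffOn hinj fun η hη => by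
        rw [mfderiv_eq_fderiv]; exact hbij η hη
  have hinv' : ContDiffOn ℝ ∞ (invFunOn (capFst p u) (ball 0 r)) (capFst p u '' ball 0 r) :=
    contMDiffOn_iff_contDiffOn.1 hinv
  exact hW.comp hinv' fun x hx => Literature.Geometry.Manifold.invFunOn_mem hx

variable [IsManifold (𝓡 4) ∞ M]

/-- The domain `capDefDom p u r` is open when `σ (ball 0 r)` is. [folklore] -/
theorem isOpen_capDefDom (hopen : IsOpen (capFst p u '' ball 0 r)) : IsOpen (capDefDom p u r) := by
  have hc : ContinuousOn (fun y => (flatPair p y).1) (chartAt (EuclideanSpace ℝ (Fin 4)) p).source :=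
    continuous_fst.comp_continuousOn (contMDiffOn_flatPair p).continuousOn
  exact hc.isOpen_inter_preimage (chartAt _ p).open_source hopen

/-- **`π_p` is smooth on its domain.** [cite: Wendl2018, Prop. 2.53 with Thm. 2.49] -/
theorem contMDiffOn_capDefFn (hslope : ContDiffOn ℝ ∞ (capSlope p u r) (capFst p u '' ball 0 r)) :
    ContMDiffOn (𝓡 4) 𝓘(ℝ, ℂ) ∞ (capDefFn p u r) (capDefDom p u r) := by
  have hΦ : ContDiffOn ℝ ∞ (fun q : ℂ × ℂ => q.2 - capSlope p u r q.1 * q.1)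
      ((capFst p u '' ball 0 r) ×ˢ univ) :=
    contDiffOn_snd.sub ((hslope.comp contDiffOn_fst fun q hq => hq.1).mul contDiffOn_fst)
  intro y hy
  have hf : ContMDiffWithinAt (𝓡 4) 𝓘(ℝ, ℂ × ℂ) ∞ (flatPair p) (capDefDom p u r) y :=
    ((contMDiffOn_flatPair p) y hy.1).mono fun y' hy' => hy'.1
  exact (hΦ _ ⟨hy.2, mem_univ _⟩).comp_contMDiffWithinAt hf fun y' hy' => ⟨hy'.2, mem_univ _⟩

end DefFn

namespace IsPencilPlane

variable {M : Type*} [TopologicalSpace M] [T2Space M] [CompactSpace M]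
  [ChartedSpace (EuclideanSpace ℝ (Fin 4)) M] [IsManifold (𝓡 4) ∞ M]
  {p : M} {J : ∀ x : punctured p, TangentSpace (𝓡 4) x →L[ℝ] TangentSpace (𝓡 4) x}
  {u : ℂ → punctured p} {b : ℂ} {ε r : ℝ}

omit [CompactSpace M] [IsManifold (𝓡 4) ∞ M] in
/-- On a disc within the cap radius, the cap lies in the chart source and its split flat
coordinates are `(σ η, W η · σ η)`. [folklore] -/
theorem flatPair_pencilCap
    (hdisc : ∀ η : ℂ, η ≠ 0 → ‖η‖ < r →
      InPuncturedChartBall p ε (u η⁻¹) ∧ 1 < ‖(pencilCoord p (u η⁻¹)).1‖)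
    {η : ℂ} (hη : η ∈ ball (0 : ℂ) r) :
    pencilCap p u η ∈ (chartAt (EuclideanSpace ℝ (Fin 4)) p).source ∧
      flatPair p (pencilCap p u η) = (capFst p u η, capW p u η * capFst p u η) := by
  have hz : η ≠ 0 → (pencilCoord p (u η⁻¹)).1 ≠ 0 := fun h0 =>
    norm_pos_iff.1 (lt_trans one_pos (hdisc η h0 (mem_ball_zero_iff.1 hη)).2)
  refine ⟨?_, ?_⟩
  · rcases eq_or_ne η 0 with rfl | h0
    · simp
    · rw [pencilCap_of_ne_zero h0]
      exact (hdisc η h0 (mem_ball_zero_iff.1 hη)).1.1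
  · rw [flatPair, extChartAt_pencilCap hz, add_sub_cancel_left]
    exact Prod.ext rfl (flatCx_capModel_cap_snd η)

omit [CompactSpace M] [IsManifold (𝓡 4) ∞ M] in
/-- **The zero set of `π_p` on its domain is exactly the cap of the disc.**
[cite: Wendl2018, Prop. 2.53 with Thm. 2.49] -/
theorem capDefFn_zeroSet
    (hdisc : ∀ η : ℂ, η ≠ 0 → ‖η‖ < r →
      InPuncturedChartBall p ε (u η⁻¹) ∧ 1 < ‖(pencilCoord p (u η⁻¹)).1‖)
    (hinj : InjOn (capFst p u) (ball 0 r)) :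
    {y | y ∈ capDefDom p u r ∧ capDefFn p u r y = 0} = pencilCap p u '' ball 0 r := by
  apply Subset.antisymm
  · rintro y ⟨⟨hsrc, η, hη, hση⟩, hzero⟩
    obtain ⟨hsrc', hpair⟩ := flatPair_pencilCap hdisc hη
    have hinv : capSlope p u r (flatPair p y).1 = capW p u η := by
      rw [← hση, capSlope_capFst hinj hη]
    have h2 : (flatPair p y).2 = capW p u η * capFst p u η := by
      have : (flatPair p y).2 - capSlope p u r (flatPair p y).1 * (flatPair p y).1 = 0 := hzero
      rw [hinv, ← hση] at this
      exact sub_eq_zero.1 this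
    have hflat : flatPair p y = flatPair p (pencilCap p u η) := by
      rw [hpair]
      exact Prod.ext hση.symm h2
    refine ⟨η, hη, ?_⟩
    have he : extChartAt (𝓡 4) p (pencilCap p u η) = extChartAt (𝓡 4) p y := by
      have := flatCx.injective hflat
      rwa [sub_left_inj, eq_comm] at this
    exact (extChartAt (𝓡 4) p).injOn (by rwa [extChartAt_source]) (by rwa [extChartAt_source]) he
  · rintro y ⟨η, hη, rfl⟩
    obtain ⟨hsrc, hpair⟩ := flatPair_pencilCap hdisc hη
    refine ⟨⟨hsrc, η, hη, by rw [hpair]⟩, ?_⟩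
    show (flatPair p (pencilCap p u η)).2 -
      capSlope p u r (flatPair p (pencilCap p u η)).1 * (flatPair p (pencilCap p u η)).1 = 0
    rw [hpair, capSlope_capFst hinj hη, sub_self]

/-- **The defining function of a closed-up member near `p`, packaged.** For a pencil member there
is `r > 0` such that: the disc of radius `r` is a good cap disc (`u (η⁻¹)` in the punctured
`ε`-chart-ball with `|z| > 1` for `0 < |η| < r`; `σ`, `W` smooth and `σ` injective with bijective
differential on it; `σ (ball 0 r)` open and `Ŵ` smooth on it), the domain `capDefDom p u r` is an
open neighbourhood of `p` on which `π_p = capDefFn p u r` is smooth, and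
`{y ∈ capDefDom p u r | π_p y = 0} = pencilCap p u '' ball 0 r`.
[cite: Wendl2018, Prop. 2.53 with Thm. 2.49] -/
theorem exists_capDefFn (h : IsPencilPlane J u b) (hε : 0 < ε)
    (hJstd : ∀ x : punctured p, InPuncturedChartBall p ε x →
      ∀ (v : TangentSpace (𝓡 4) x) (c : EuclideanSpace ℝ (Fin 4)),
        inner ℝ (fderiv ℝ inversion (extChartAt (𝓡 4) p x.1 - extChartAt (𝓡 4) p p)
          (mfderiv (𝓡 4) 𝓘(ℝ, EuclideanSpace ℝ (Fin 4))
            (fun z : punctured p => extChartAt (𝓡 4) p z.1) x (J x v))) c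
        = stdSymplecticForm (fderiv ℝ inversion (extChartAt (𝓡 4) p x.1 - extChartAt (𝓡 4) p p)
          (mfderiv (𝓡 4) 𝓘(ℝ, EuclideanSpace ℝ (Fin 4))
            (fun z : punctured p => extChartAt (𝓡 4) p z.1) x v)) c) :
    ∃ r : ℝ, 0 < r ∧
      (∀ η : ℂ, η ≠ 0 → ‖η‖ < r →
        InPuncturedChartBall p ε (u η⁻¹) ∧ 1 < ‖(pencilCoord p (u η⁻¹)).1‖) ∧
      ContDiffOn ℝ ∞ (capFst p u) (ball 0 r) ∧ ContDiffOn ℝ ∞ (capW p u) (ball 0 r) ∧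
      InjOn (capFst p u) (ball 0 r) ∧
      (∀ η ∈ ball (0 : ℂ) r, Bijective (fderiv ℝ (capFst p u) η)) ∧
      IsOpen (capFst p u '' ball 0 r) ∧
      ContDiffOn ℝ ∞ (capSlope p u r) (capFst p u '' ball 0 r) ∧
      IsOpen (capDefDom p u r) ∧ p ∈ capDefDom p u r ∧
      ContMDiffOn (𝓡 4) 𝓘(ℝ, ℂ) ∞ (capDefFn p u r) (capDefDom p u r) ∧
      {y | y ∈ capDefDom p u r ∧ capDefFn p u r y = 0} = pencilCap p u '' ball 0 r := by
  haveI : SecondCountableTopology M := by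
    exact ChartedSpace.secondCountable_of_sigmaCompact (EuclideanSpace ℝ (Fin 4)) M
  obtain ⟨r, hr, hdisc, hσ, hW, hinj, hbij⟩ := h.exists_capFst_goodDisc hε hJstd
  have hopen := isOpen_image_capFst hσ hbij
  have hslope := contDiffOn_capSlope hσ hW hinj hbij
  exact ⟨r, hr, hdisc, hσ, hW, hinj, hbij, hopen, hslope, isOpen_capDefDom hopen,
    base_mem_capDefDom hr, contMDiffOn_capDefFn hslope, capDefFn_zeroSet hdisc hinj⟩

end IsPencilPlane

end Literature.Geometry.Symplectic
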